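import Summits.QuantumFields.YangMills.Theorems.UnitScaleTiltHalvingCompetitorMapFrames
import Summits.QuantumFields.YangMills.Theorems.UnitScaleTiltHalvingCompetitorMapFramesSU2
import Summits.QuantumFields.YangMills.Theorems.UnitScaleTiltProp8ChartBridgeAllL
import Literature.MathematicalPhysics.QuantumFieldTheory.Balaban1983to89.T3PrintedRegularOrbits
import HarnessLib

/-!
# Route `UnitScaleTilt`, crux K1 child «MinimiserStabilityRegPr» (stmt-QuantumFields-19200), registered stub `stub_halvingStep` (H), the S11∕S12 junction of the
# end-to-end knit — **THE (Φ-1) FIBRE HALF FOR THE LOCALISED COMPETITOR MAP, ASSEMBLED** (LEAD ★w5-19200 g4 RULING L-1 (R1); census #45): a competitor whose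
# double-bar constraint data are those of a gauge copy of the minimiser, near-flat under the blocks of the cube sequence, HAS AN `SU(2)` GAUGE COPY IN THE FIBRE `𝔅_k(V)`

Cell `ym3-torus` (HUMAN RULING D-0037, YM ladder rung R3 — continuum SU(2) YM₃ on the torus is a RUNG, not the Clay problem), width seat `ym-ust-19200-w1` gen 7.
`--supports stmt-QuantumFields-19200 --as helper`; def-free, 0 sorry, standard axioms; counts toward nothing by itself.

THE CHAIN (every arrow a landed theorem).  `W` = the competitor, `U` = the minimiser, `uS` an `SU(2)` gauge map, `D` the nested family (`D.k = K − n`):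
(1) ✓`HalvingCompetitorMapFrames.exists_pred_gauge_emlIterU_top` (tower pinning + frame quotient in the group, predicate «unitary ∧ det = 1», small-readable blocks
`Sm j := Ω_j`, block frames in `SU(2)` by ✓`HalvingCompetitorMapFramesSU2.su2_vframeU_dbarIterU` from near-flatness under the `Ω`-blocks): `Ū^{(k)}(Ŵ) = (Ū^{(k)}(Û))^{g}` with
`g` `SU(2)`-valued (`Ŵ`, `Û` the units readings); (2) ✓`Prop8ChartAllL.coe_emlIterU_unitsField_T3_allL` (the unguarded `eml` iterate IS the `ℰp`-descent for (6)-regular fields):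
`D_{n,K}` of `W` is the `SU(2)` gauge copy `w • D_{n,K}U`; (3) lit ✓`T3PrintedRegularOrbits.descendTo_gaugeAct`∕`liftTransfTo`∕`descTransf_liftTransfTo`: the lift `h` of
`w⁻¹` gives `D_{n,K}(h • W) = D_{n,K}U`, i.e. `h • W ∈ 𝔅_k(D_{n,K}U)`.

WHAT IS PROVED (ns `…Theorems.HalvingCompetitorMapFibre`).
* §1 helpers: `su2_toUnits` (the units of `SU(2)`-valued bond variables are unitary with `det = 1`), `unitsField_toUField_gaugeAct` (units reading of a gauge copy)
  (`w⁻¹ • (w • V) = V` is ✓`Prop7OrbitTransport.gaugeAct_inv_gaugeAct_self`, re-proved inline to keep the import list short).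
* §2 ★★★ `exists_gaugeAct_mem_fibre` — for `W U : SU(2)^{bonds}` regular (`PlaqSmall (regThreshold … ε₀)`, `10⁷L³ε₀ ≤ 1`), `uS`, the nested family `D` with `D.k = K − n`,
  constraint data `U̿(Ŵ)(idx) = U̿(unitsField(toUField(uS • U)))(idx)` at every `idx : BondIdx D`, and near-flatness `‖W b − 1‖, ‖(uS • U) b − 1‖ ≤ s_j` on the fine bonds under
  every block of `Ω_{j+1}` with the B2 budgets `8·3800·ℓ²·L^{j+1}·s_j ≤ 1`: `∃ h : GaugeTransf … SU(2), h • W ∈ fibre F ℰp n K _ (D_{n,K} U)` — the `hfib` binder of the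
  localised knit (★w8-19200 s2 `hpair_of_hcrit_local`), for `W := Φloc X`, once its inputs are read from the chart (index pinning: FILE E v3 exactness + (ii′); near-flatness:
  the weighted ball).
HONEST SCOPE: assembly over landed theorems; the two displayed inputs (index pinning, near-flatness) are the knit's; nothing of print is asserted; NOT a claim about the stub, the
crux, the rung or a mass gap.

References: T. Bałaban, CMP **98** (1985) 17–51 [Balaban1985Averaging] ((11)–(13) p.19, (89) p.31, (92) p.31, (97)–(100) p.32, (110) p.34); CMP **102** (1985) 277–309
[Balaban1985Variational] ((3)–(4), (6) p.278, (144) p.300, (150) p.301, (156) p.302); CMP **109** (1987) 249–301 [Balaban1987RG1] ((0.4), (0.11) p.253).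
-/

set_option autoImplicit false

noncomputable section

open scoped BigOperators Matrix.Norms.L2Operator

namespace Summit.QuantumFields.YangMills.Theorems.HalvingCompetitorMapFibre

open Literature.MathematicalPhysics.QuantumFieldTheory.Balaban1983to89
open Literature.MathematicalPhysics.QuantumFieldTheory.Balaban1983to89.T3ContinuumYM3Torus
open Literature.MathematicalPhysics.QuantumFieldTheory.Balaban1983to89.T3UnitLawDensityEML (ℰp)
open Literature.MathematicalPhysics.QuantumFieldTheory.Balaban1983to89.T3TiltDescent (descendTo)
open Literature.MathematicalPhysics.QuantumFieldTheory.Balaban1983to89.T3ConstrainedMinimiser (fibre)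
open Literature.MathematicalPhysics.QuantumFieldTheory.Balaban1983to89.T3RegularMinimiser (regThreshold)
open Literature.MathematicalPhysics.QuantumFieldTheory.Balaban1983to89.T3PrintedRegularOrbits (descTransf descendTo_gaugeAct liftTransfTo descTransf_liftTransfTo
  toUField_gaugeAct)
open T4Continuum BlockAveraging ExpMeanLog
open B10Eq27TorusAxialLog (gaugeActT gaugeActT_apply unitsField val_unitsField toUField suIncl val_suIncl)
open B10Eq68TorusRegularity (unitsField_gaugeAct)
open B5Eq118OneStroke (iterBlockOf)
open B6SectADomainsV1 (Domains)
open B6SectAOperatorsV1 (BondIdx)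
open Summit.QuantumFields.YangMills.Theorems.Prop8Chart (emlIterU)
open Summit.QuantumFields.YangMills.Theorems.Prop8ChartDoubleBar (dbarIterU vframeU)
open Summit.QuantumFields.YangMills.Theorems.Prop8ChartAllL (coe_emlIterU_unitsField_T3_allL)
open Summit.QuantumFields.YangMills.Theorems.HalvingCompetitorMapFrames (exists_pred_gauge_emlIterU_top)
open Summit.QuantumFields.YangMills.Theorems.HalvingCompetitorMapFramesSU2 (su2_pred_one su2_pred_mul su2_pred_inv su2_vframeU_dbarIterU)

/-! ## §1 Helpers -/

section Helpers

variable {P : Params}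

/-- the units of an `SU(2)`-valued configuration are unitary with `det = 1`. [cite: Balaban1985Averaging, (19) p.21] -/
theorem su2_toUnits (W : GaugeField P 0 (Matrix.specialUnitaryGroup (Fin 2) ℂ)) (b : PBond P 0) :
    ((unitsField (toUField W) b : (Matrix (Fin 2) (Fin 2) ℂ)ˣ) : Matrix (Fin 2) (Fin 2) ℂ) ∈ Matrix.unitaryGroup (Fin 2) ℂ ∧
      ((unitsField (toUField W) b : (Matrix (Fin 2) (Fin 2) ℂ)ˣ) : Matrix (Fin 2) (Fin 2) ℂ).det = 1 := by
  rw [val_unitsField]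
  show ((suIncl (W b) : Matrix.unitaryGroup (Fin 2) ℂ) : Matrix (Fin 2) (Fin 2) ℂ) ∈ Matrix.unitaryGroup (Fin 2) ℂ ∧ _
  rw [val_suIncl]
  exact Matrix.mem_specialUnitaryGroup_iff.1 (W b).2

/-- the units reading of a gauge copy: `unitsField (toUField (u • U)) = (unitsField (toUField U))^{û}`, `û x = toUnits (suIncl (u x))`. [cite: Balaban1985Averaging, (8) p.19] -/
theorem unitsField_toUField_gaugeAct (u : GaugeTransf P 0 (Matrix.specialUnitaryGroup (Fin 2) ℂ)) (U : GaugeField P 0 (Matrix.specialUnitaryGroup (Fin 2) ℂ)) :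
    unitsField (toUField (GaugeField.gaugeAct u U)) = gaugeActT (fun x => Unitary.toUnits (suIncl (u x))) (unitsField (toUField U)) := by
  rw [toUField_gaugeAct, unitsField_gaugeAct]

end Helpers

/-! ## §2 The competitor has an `SU(2)` gauge copy in the fibre -/

section Fibre

variable (F : T3Family) (n K : ℕ)

/-- ★★★ **THE (Φ-1) FIBRE HALF FOR THE LOCALISED COMPETITOR MAP.**  `W`, `U` regular `SU(2)` configurations of the member (`PlaqSmall (regThreshold F n K ε₀)`, `0 < ε₀`,
`10⁷L³ε₀ ≤ 1`), `uS` an `SU(2)` gauge map, `D` a nested family with `D.k = K − n`; IF the double-bar constraint data of `W` at every index of `D` are those of the gauge copy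
`uS • U`, and both `W` and `uS • U` are within `s_j` of `1` on the fine bonds under every block of `Ω_{j+1}` (B2 budget `8·3800·ℓ²·L^{j+1}·s_j ≤ 1`), THEN some `SU(2)` gauge copy
of `W` lies in the fibre of `U`: `∃ h, h • W ∈ 𝔅_k(D_{n,K} U)`.  Chain: frame-quotient gauge in `SU(2)` (✓`exists_pred_gauge_emlIterU_top` with ✓`su2_vframeU_dbarIterU`), the
`eml`∕`ℰp` dictionary (✓`coe_emlIterU_unitsField_T3_allL`), descent covariance and the lift (lit ✓`descendTo_gaugeAct`, ✓`liftTransfTo`).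
[cite: Balaban1985Variational, (3)-(4) p.278, (6) p.278, (150) p.301, (156) p.302; Balaban1985Averaging, (11)-(13) p.19, (92) p.31; Balaban1987RG1, (0.11) p.253] -/
theorem exists_gaugeAct_mem_fibre (hnK : n ≤ K) (D : Domains (F.P K)) (hDk : D.k = K - n) {ε₀ : ℝ} (hε₀ : 0 < ε₀)
    (hε : 10 ^ 7 * (F.L : ℝ) ^ 3 * ε₀ ≤ 1)
    (W U : GaugeField (F.P K) 0 (Matrix.specialUnitaryGroup (Fin 2) ℂ)) (hW : PlaqSmall (regThreshold F n K ε₀) W)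
    (hU : PlaqSmall (regThreshold F n K ε₀) U) (uS : GaugeTransf (F.P K) 0 (Matrix.specialUnitaryGroup (Fin 2) ℂ))
    (hidx : ∀ idx : BondIdx D, dbarIterU (idx.1.1 : ℕ) (unitsField (toUField W)) idx.1.2 =
      dbarIterU (idx.1.1 : ℕ) (unitsField (toUField (GaugeField.gaugeAct uS U))) idx.1.2)
    (s : ℕ → ℝ) (hs0 : ∀ j, 0 ≤ s j) (hbudget : ∀ j, 8 * 3800 * ((((F.P K).d + 2) * (F.P K).L : ℕ) : ℝ) ^ 2 * ((F.P K).L : ℝ) ^ (j + 1) * s j ≤ 1)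
    (hWs : ∀ (j : ℕ) (z : Site (F.P K) (j + 1)), z ∈ D.Om (j + 1) → ∀ b : PBond (F.P K) 0, iterBlockOf (j + 1) b.src = z → iterBlockOf (j + 1) b.tgt = z →
      ‖((W b : Matrix.specialUnitaryGroup (Fin 2) ℂ) : Matrix (Fin 2) (Fin 2) ℂ) - 1‖ ≤ s j)
    (hUs : ∀ (j : ℕ) (z : Site (F.P K) (j + 1)), z ∈ D.Om (j + 1) → ∀ b : PBond (F.P K) 0, iterBlockOf (j + 1) b.src = z → iterBlockOf (j + 1) b.tgt = z →
      ‖((GaugeField.gaugeAct uS U b : Matrix.specialUnitaryGroup (Fin 2) ℂ) : Matrix (Fin 2) (Fin 2) ℂ) - 1‖ ≤ s j) :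
    ∃ h : GaugeTransf (F.P K) 0 (Matrix.specialUnitaryGroup (Fin 2) ℂ), GaugeField.gaugeAct h W ∈ fibre F ℰp n K hnK (descendTo F ℰp n K hnK U) := by
  -- the gauge map read in the units, and the units reading of the gauge copy
  have hcopy : unitsField (toUField (GaugeField.gaugeAct uS U)) =
      gaugeActT (fun x => Unitary.toUnits (suIncl (uS x))) (unitsField (toUField U)) := unitsField_toUField_gaugeAct uS U
  -- the predicate «unitary with det = 1» on the units
  let p : (Matrix (Fin 2) (Fin 2) ℂ)ˣ → Prop := fun u =>
    (u : Matrix (Fin 2) (Fin 2) ℂ) ∈ Matrix.unitaryGroup (Fin 2) ℂ ∧ (u : Matrix (Fin 2) (Fin 2) ℂ).det = 1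
  have hp1 : p 1 := su2_pred_one
  have hpg₀ : ∀ x, p (Unitary.toUnits (suIncl (uS x))) := fun x => by
    show ((suIncl (uS x) : Matrix.unitaryGroup (Fin 2) ℂ) : Matrix (Fin 2) (Fin 2) ℂ) ∈ Matrix.unitaryGroup (Fin 2) ℂ ∧ _
    rw [val_suIncl]
    exact Matrix.mem_specialUnitaryGroup_iff.1 (uS x).2
  -- the block-centre tower of the gauge map
  let us : (i : ℕ) → GaugeTransf (F.P K) i (Matrix (Fin 2) (Fin 2) ℂ)ˣ :=
    fun i => Nat.rec (motive := fun i => Site (F.P K) i → (Matrix (Fin 2) (Fin 2) ℂ)ˣ) (fun x => Unitary.toUnits (suIncl (uS x))) (fun _ ui y => ui (emb y)) i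
  have hus0 : us 0 = fun x => Unitary.toUnits (suIncl (uS x)) := rfl
  have hus : ∀ (i : ℕ) (y : Site (F.P K) (i + 1)), us (i + 1) y = us i (emb y) := fun _ _ => rfl
  have hpus : ∀ (i : ℕ) (y : Site (F.P K) i), p (us i y) := by
    intro i
    induction i with
    | zero => intro y; exact hpg₀ y
    | succ i ih => intro y; rw [hus]; exact ih _
  -- index data, in the form of the frames file
  have hidx' : ∀ idx : BondIdx D, dbarIterU (idx.1.1 : ℕ) (unitsField (toUField W)) idx.1.2 =
      dbarIterU (idx.1.1 : ℕ) (gaugeActT (fun x => Unitary.toUnits (suIncl (uS x))) (unitsField (toUField U))) idx.1.2 := fun idx => by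
    rw [← hcopy]; exact hidx idx
  -- the small-readable blocks `Sm j := Ω_j`: levels in range, `emb`-closed
  have hlev : ∀ (j : ℕ) (z : Site (F.P K) (j + 1)), z ∈ (D.Om (j + 1) : Set (Site (F.P K) (j + 1))) → j + 1 ≤ (F.P K).m + (F.P K).K := by
    intro j z hz
    have hz' : z ∈ D.Om (j + 1) := hz
    have : j + 1 ≤ D.k := by
      by_contra hlt
      rw [D.Om_eq_empty (by omega)] at hz'
      exact absurd hz' (Finset.notMem_empty _)
    exact this.trans D.hk
  have hemb : ∀ (j : ℕ) (z : Site (F.P K) (j + 1)), z ∈ (D.Om (j + 1) : Set (Site (F.P K) (j + 1))) → emb z ∈ (D.Om j : Set (Site (F.P K) j)) := by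
    intro j z hz
    have hz' : z ∈ D.Om (j + 1) := hz
    show emb z ∈ D.Om j
    exact D.nested (emb z) (by rw [Site.blockOf_emb (hlev j z hz)]; exact hz')
  have hΩ : ∀ (j : ℕ) (y : Site (F.P K) (j + 1)), j + 1 ≤ D.k → y ∈ D.Om (j + 1) → y ∈ (D.Om (j + 1) : Set (Site (F.P K) (j + 1))) :=
    fun _ _ _ hy => hy
  -- the block frames of both towers are in SU(2) on the `Ω`-blocks
  have hvf : ∀ (j : ℕ) (z : Site (F.P K) (j + 1)), z ∈ (D.Om (j + 1) : Set (Site (F.P K) (j + 1))) →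
      p (vframeU (dbarIterU j (unitsField (toUField W))) z) :=
    fun j z hz => su2_vframeU_dbarIterU (hlev j z hz) z _ (hs0 j) (hbudget j)
      (fun b hs ht => by rw [val_unitsField]; exact hWs j z hz b hs ht) fun b _ _ => su2_toUnits W b
  have hvf' : ∀ (j : ℕ) (z : Site (F.P K) (j + 1)), z ∈ (D.Om (j + 1) : Set (Site (F.P K) (j + 1))) →
      p (vframeU (dbarIterU j (gaugeActT (fun x => Unitary.toUnits (suIncl (uS x))) (unitsField (toUField U)))) z) :=
    fun j z hz => by
      rw [← hcopy]
      exact su2_vframeU_dbarIterU (hlev j z hz) z _ (hs0 j) (hbudget j)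
        (fun b hs ht => by rw [val_unitsField]; exact hUs j z hz b hs ht) fun b _ _ => su2_toUnits (GaugeField.gaugeAct uS U) b
  -- (1) the frame-quotient gauge, SU(2)-valued
  obtain ⟨g, hgp, hg⟩ := exists_pred_gauge_emlIterU_top D p hp1 su2_pred_mul su2_pred_inv (fun x => Unitary.toUnits (suIncl (uS x))) hidx'
    (fun j => (D.Om j : Set (Site (F.P K) j))) hemb hΩ hvf hvf' us hus0 hus (hpus D.k)
  -- (2) the `eml` iterate is the `ℰp`-descent (both fields regular)
  have hbrW := coe_emlIterU_unitsField_T3_allL F n K hε₀ hε W hW (K - n) le_rfl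
  have hbrU := coe_emlIterU_unitsField_T3_allL F n K hε₀ hε U hU (K - n) le_rfl
  -- pass to the height `K − n` (`D.k = K − n`)
  revert g
  rw [hDk]
  intro g hgp hg
  -- the coarse gauge as an SU(2) map on the height-`(K−n)` lattice
  let wK : GaugeTransf (F.P K) (K - n) (Matrix.specialUnitaryGroup (Fin 2) ℂ) := fun y =>
    ⟨((g y : (Matrix (Fin 2) (Fin 2) ℂ)ˣ) : Matrix (Fin 2) (Fin 2) ℂ), Matrix.mem_specialUnitaryGroup_iff.2 (hgp y)⟩
  have hiter : Averaging.iter (fun i => blockAvg (P := F.P K) (j := i) (expMeanLogSU (n := Fin 2))) (K - n) W =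
      GaugeField.gaugeAct wK (Averaging.iter (fun i => blockAvg (P := F.P K) (j := i) (expMeanLogSU (n := Fin 2))) (K - n) U) := by
    funext b
    apply Subtype.ext
    have h3 : emlIterU (K - n) (unitsField (toUField W)) b = gaugeActT g (emlIterU (K - n) (unitsField (toUField U))) b := by rw [hg]
    rw [gaugeActT_apply] at h3
    have h3' := congrArg (fun u : (Matrix (Fin 2) (Fin 2) ℂ)ˣ => (u : Matrix (Fin 2) (Fin 2) ℂ)) h3
    simp only [Units.val_mul] at h3'
    -- `↑((g y)⁻¹) = star ↑(g y)` (unitary)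
    have hinv : (((g b.tgt)⁻¹ : (Matrix (Fin 2) (Fin 2) ℂ)ˣ) : Matrix (Fin 2) (Fin 2) ℂ) = star ((g b.tgt : (Matrix (Fin 2) (Fin 2) ℂ)ˣ) : Matrix (Fin 2) (Fin 2) ℂ) :=
      Units.inv_eq_of_mul_eq_one_right (Unitary.mul_star_self_of_mem (hgp b.tgt).1)
    rw [hinv, hbrW b, hbrU b] at h3'
    rw [h3']
    show _ = ((wK b.src * Averaging.iter (fun i => blockAvg (P := F.P K) (j := i) (expMeanLogSU (n := Fin 2))) (K - n) U b * (wK b.tgt)⁻¹ :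
      Matrix.specialUnitaryGroup (Fin 2) ℂ) : Matrix (Fin 2) (Fin 2) ℂ)
    rw [Submonoid.coe_mul, Submonoid.coe_mul, ← Matrix.star_eq_inv, Matrix.specialUnitaryGroup.coe_star]
  -- (3) descent covariance and the lift
  let w : GaugeTransf (F.P n) 0 (Matrix.specialUnitaryGroup (Fin 2) ℂ) := fun x =>
    wK (T3LevelShift.siteShift (F.sitesPerDir_eq (m := F.m) (K := n) (j := 0) (m' := F.m) (K' := K) (j' := K - n) (by omega)) x)
  have hdesc : descendTo F ℰp n K hnK W = GaugeField.gaugeAct w (descendTo F ℰp n K hnK U) := by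
    unfold descendTo
    show T3LevelShift.fieldShift _ (Averaging.iter (fun i => blockAvg (P := F.P K) (j := i) (expMeanLogSU (n := Fin 2))) (K - n) W) = _
    rw [hiter]
    exact T3LevelShift.fieldShift_gaugeAct _ wK _
  -- `w⁻¹ • (w • V) = V` (= ✓`Prop7OrbitTransport.gaugeAct_inv_gaugeAct_self`, inline)
  have hinv : GaugeField.gaugeAct (fun x => (w x)⁻¹) (GaugeField.gaugeAct w (descendTo F ℰp n K hnK U)) = descendTo F ℰp n K hnK U := by
    funext b
    simp only [GaugeField.gaugeAct, inv_inv]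
    group
  refine ⟨liftTransfTo F n K hnK (fun x => (w x)⁻¹), ?_⟩
  show descendTo F ℰp n K hnK (GaugeField.gaugeAct (liftTransfTo F n K hnK (fun x => (w x)⁻¹)) W) = descendTo F ℰp n K hnK U
  rw [descendTo_gaugeAct, descTransf_liftTransfTo, hdesc, hinv]

end Fibre

end Summit.QuantumFields.YangMills.Theorems.HalvingCompetitorMapFibre

end
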